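import Mathlib.Tactic.Ring
import Mathlib.Data.Real.Basic
import HarnessLib

/-!
# Conjecture N (hodge-weil ladder, GAPS G51b), format (4,2): the (P1),(P2) ELIMINATION SYSTEM for one E-root and its determinant `D`

Prover 2, generation 12 (note `run/shared/lean/b2b/hodge-weil/b2b-hweil-pv2-g12/VERTEX-FORM-G12.md` ADDENDUM 4, CONJECTURE D). Companion of
`WeilClassTestEscapeDirections.lean` (g11's cluster form) and `WeilClassTestVertexGauge.lean`. Setting: format (4,2), E-roots `1..4`, F-roots `5,6`,
positions `y`, real charges `u`, mass-2 centred `Y, Z`; the E-root `1` is singled out and the other five roots form the CLUSTER, written in their own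
(mass-1) centred coordinates `y_k = Y_k + Y₁`, `ζ_k = Z_k + Z₁` (`k = 2..6`; cluster sums `CSy = Σεy²`, `CSz = Σεζ²`, `CSyz`, `CSy2z = Σεy²ζ`,
`CSyz2 = Σεyζ²`, `CSz3 = Σεζ³`). IDENTITIES (all `ring`, no hypothesis):
* `P1_cluster_frame` : `(P1) = CSy2z − Z₁·CSy − 2Y₁·CSyz`;  `P2_cluster_frame` : `(P2) = CSyz2 − 2Z₁·CSyz − Y₁·CSz`;  `P4_cluster_frame` :
  `(P4) = CSz3 − 3Z₁·CSz` — on the pure locus, (P1) and (P2) are a LINEAR SYSTEM for `(Y₁, Z₁)` with matrix `[[2CSyz, CSy],[CSz, 2CSyz]]` and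
  DETERMINANT `D = 4CSyz² − CSy·CSz`, and (P4) gives `Z₁ = CSz3/(3CSz)`;
* `cramer_position` : `D·Y₁ − (2CSyz·CSy2z − CSy·CSyz2) = −2CSyz·(P1) + CSy·(P2)`;  `cramer_charge` : `D·Z₁ − (2CSyz·CSyz2 − CSz·CSy2z) = CSz·(P1) − 2CSyz·(P2)`;
* `cluster_moments_full` : `CSy = S_y − 2Y₁²`, `CSz = S_u − 2Z₁²`, `CSyz = S_{yZ} − 2Y₁Z₁` (so `−CSz` is the wall function `w₁ = 2Z₁² − S_u` and g11's
  `Δ = CSy·CSz − 4CSyz² − 6CSz² = −D − 6CSz²`).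
CONJECTURE D (note A4.2; data 12 006/12 006, needs (P1)): `D ≥ 0` at every root of a pure pairwise-ample configuration; for the two CONFINED E-roots
(`CSz < 0`, sign law) this is the content, and it would give `Δ ≤ −6w²`. Nothing here is a rung, a door edge or a cited fact; no statement of Markman's
papers is used. New cell result ⇒ Summits/.
-/

set_option linter.dupNamespace false

namespace Summit.HodgeConjecture.HodgeConjecture.WeilClassTestEliminationSystem

/-- (P1) in the cluster frame of E-root 1: `ΣεY²Z = CSy2z − Z₁·CSy − 2Y₁·CSyz`. -/
theorem P1_cluster_frame (y₁ y₂ y₃ y₄ y₅ y₆ u₁ u₂ u₃ u₄ u₅ u₆ : ℝ) :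
    let yb : ℝ := (y₁ + y₂ + y₃ + y₄ - y₅ - y₆) / 2
    let ub : ℝ := (u₁ + u₂ + u₃ + u₄ - u₅ - u₆) / 2
    let Y₁ : ℝ := y₁ - yb
    let Y₂ : ℝ := y₂ - yb
    let Y₃ : ℝ := y₃ - yb
    let Y₄ : ℝ := y₄ - yb
    let Y₅ : ℝ := y₅ - yb
    let Y₆ : ℝ := y₆ - yb
    let Z₁ : ℝ := u₁ - ub
    let Z₂ : ℝ := u₂ - ub
    let Z₃ : ℝ := u₃ - ub
    let Z₄ : ℝ := u₄ - ub
    let Z₅ : ℝ := u₅ - ub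
    let Z₆ : ℝ := u₆ - ub
    let P1 : ℝ := Y₁ ^ 2 * Z₁ + Y₂ ^ 2 * Z₂ + Y₃ ^ 2 * Z₃ + Y₄ ^ 2 * Z₄ - (Y₅ ^ 2 * Z₅ + Y₆ ^ 2 * Z₆)
    let CSy : ℝ := (Y₂ + Y₁) ^ 2 + (Y₃ + Y₁) ^ 2 + (Y₄ + Y₁) ^ 2 - ((Y₅ + Y₁) ^ 2 + (Y₆ + Y₁) ^ 2)
    let CSyz : ℝ := (Y₂ + Y₁) * (Z₂ + Z₁) + (Y₃ + Y₁) * (Z₃ + Z₁) + (Y₄ + Y₁) * (Z₄ + Z₁) - ((Y₅ + Y₁) * (Z₅ + Z₁) + (Y₆ + Y₁) * (Z₆ + Z₁))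
    let CSy2z : ℝ := (Y₂ + Y₁) ^ 2 * (Z₂ + Z₁) + (Y₃ + Y₁) ^ 2 * (Z₃ + Z₁) + (Y₄ + Y₁) ^ 2 * (Z₄ + Z₁) - ((Y₅ + Y₁) ^ 2 * (Z₅ + Z₁) + (Y₆ + Y₁) ^ 2 * (Z₆ + Z₁))
    P1 = CSy2z - Z₁ * CSy - 2 * Y₁ * CSyz := by
  intro yb ub Y₁ Y₂ Y₃ Y₄ Y₅ Y₆ Z₁ Z₂ Z₃ Z₄ Z₅ Z₆ P1 CSy CSyz CSy2z
  simp only [CSy2z, CSyz, CSy, P1, Z₆, Z₅, Z₄, Z₃, Z₂, Z₁, Y₆, Y₅, Y₄, Y₃, Y₂, Y₁, ub, yb]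
  ring

/-- (P2) in the cluster frame of E-root 1: `ΣεYZ² = CSyz2 − 2Z₁·CSyz − Y₁·CSz`. -/
theorem P2_cluster_frame (y₁ y₂ y₃ y₄ y₅ y₆ u₁ u₂ u₃ u₄ u₅ u₆ : ℝ) :
    let yb : ℝ := (y₁ + y₂ + y₃ + y₄ - y₅ - y₆) / 2
    let ub : ℝ := (u₁ + u₂ + u₃ + u₄ - u₅ - u₆) / 2
    let Y₁ : ℝ := y₁ - yb
    let Y₂ : ℝ := y₂ - yb
    let Y₃ : ℝ := y₃ - yb
    let Y₄ : ℝ := y₄ - yb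
    let Y₅ : ℝ := y₅ - yb
    let Y₆ : ℝ := y₆ - yb
    let Z₁ : ℝ := u₁ - ub
    let Z₂ : ℝ := u₂ - ub
    let Z₃ : ℝ := u₃ - ub
    let Z₄ : ℝ := u₄ - ub
    let Z₅ : ℝ := u₅ - ub
    let Z₆ : ℝ := u₆ - ub
    let P2 : ℝ := Y₁ * Z₁ ^ 2 + Y₂ * Z₂ ^ 2 + Y₃ * Z₃ ^ 2 + Y₄ * Z₄ ^ 2 - (Y₅ * Z₅ ^ 2 + Y₆ * Z₆ ^ 2)
    let CSz : ℝ := (Z₂ + Z₁) ^ 2 + (Z₃ + Z₁) ^ 2 + (Z₄ + Z₁) ^ 2 - ((Z₅ + Z₁) ^ 2 + (Z₆ + Z₁) ^ 2)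
    let CSyz : ℝ := (Y₂ + Y₁) * (Z₂ + Z₁) + (Y₃ + Y₁) * (Z₃ + Z₁) + (Y₄ + Y₁) * (Z₄ + Z₁) - ((Y₅ + Y₁) * (Z₅ + Z₁) + (Y₆ + Y₁) * (Z₆ + Z₁))
    let CSyz2 : ℝ := (Y₂ + Y₁) * (Z₂ + Z₁) ^ 2 + (Y₃ + Y₁) * (Z₃ + Z₁) ^ 2 + (Y₄ + Y₁) * (Z₄ + Z₁) ^ 2 - ((Y₅ + Y₁) * (Z₅ + Z₁) ^ 2 + (Y₆ + Y₁) * (Z₆ + Z₁) ^ 2)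
    P2 = CSyz2 - 2 * Z₁ * CSyz - Y₁ * CSz := by
  intro yb ub Y₁ Y₂ Y₃ Y₄ Y₅ Y₆ Z₁ Z₂ Z₃ Z₄ Z₅ Z₆ P2 CSz CSyz CSyz2
  simp only [CSyz2, CSyz, CSz, P2, Z₆, Z₅, Z₄, Z₃, Z₂, Z₁, Y₆, Y₅, Y₄, Y₃, Y₂, Y₁, ub, yb]
  ring

/-- (P4) in the cluster frame of E-root 1: `ΣεZ³ = CSz3 − 3Z₁·CSz`. -/
theorem P4_cluster_frame (u₁ u₂ u₃ u₄ u₅ u₆ : ℝ) :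
    let ub : ℝ := (u₁ + u₂ + u₃ + u₄ - u₅ - u₆) / 2
    let Z₁ : ℝ := u₁ - ub
    let Z₂ : ℝ := u₂ - ub
    let Z₃ : ℝ := u₃ - ub
    let Z₄ : ℝ := u₄ - ub
    let Z₅ : ℝ := u₅ - ub
    let Z₆ : ℝ := u₆ - ub
    let P4 : ℝ := Z₁ ^ 3 + Z₂ ^ 3 + Z₃ ^ 3 + Z₄ ^ 3 - (Z₅ ^ 3 + Z₆ ^ 3)
    let CSz : ℝ := (Z₂ + Z₁) ^ 2 + (Z₃ + Z₁) ^ 2 + (Z₄ + Z₁) ^ 2 - ((Z₅ + Z₁) ^ 2 + (Z₆ + Z₁) ^ 2)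
    let CSz3 : ℝ := (Z₂ + Z₁) ^ 3 + (Z₃ + Z₁) ^ 3 + (Z₄ + Z₁) ^ 3 - ((Z₅ + Z₁) ^ 3 + (Z₆ + Z₁) ^ 3)
    P4 = CSz3 - 3 * Z₁ * CSz := by
  intro ub Z₁ Z₂ Z₃ Z₄ Z₅ Z₆ P4 CSz CSz3
  simp only [CSz3, CSz, P4, Z₆, Z₅, Z₄, Z₃, Z₂, Z₁, ub]
  ring

/-- Cramer for the position of E-root 1: `D·Y₁ − (2CSyz·CSy2z − CSy·CSyz2) = −2CSyz·(P1) + CSy·(P2)`; on the pure locus `D·Y₁ = 2CSyz·CSy2z − CSy·CSyz2`. -/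
theorem cramer_position (y₁ y₂ y₃ y₄ y₅ y₆ u₁ u₂ u₃ u₄ u₅ u₆ : ℝ) :
    let yb : ℝ := (y₁ + y₂ + y₃ + y₄ - y₅ - y₆) / 2
    let ub : ℝ := (u₁ + u₂ + u₃ + u₄ - u₅ - u₆) / 2
    let Y₁ : ℝ := y₁ - yb
    let Y₂ : ℝ := y₂ - yb
    let Y₃ : ℝ := y₃ - yb
    let Y₄ : ℝ := y₄ - yb
    let Y₅ : ℝ := y₅ - yb
    let Y₆ : ℝ := y₆ - yb
    let Z₁ : ℝ := u₁ - ub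
    let Z₂ : ℝ := u₂ - ub
    let Z₃ : ℝ := u₃ - ub
    let Z₄ : ℝ := u₄ - ub
    let Z₅ : ℝ := u₅ - ub
    let Z₆ : ℝ := u₆ - ub
    let P1 : ℝ := Y₁ ^ 2 * Z₁ + Y₂ ^ 2 * Z₂ + Y₃ ^ 2 * Z₃ + Y₄ ^ 2 * Z₄ - (Y₅ ^ 2 * Z₅ + Y₆ ^ 2 * Z₆)
    let P2 : ℝ := Y₁ * Z₁ ^ 2 + Y₂ * Z₂ ^ 2 + Y₃ * Z₃ ^ 2 + Y₄ * Z₄ ^ 2 - (Y₅ * Z₅ ^ 2 + Y₆ * Z₆ ^ 2)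
    let CSy : ℝ := (Y₂ + Y₁) ^ 2 + (Y₃ + Y₁) ^ 2 + (Y₄ + Y₁) ^ 2 - ((Y₅ + Y₁) ^ 2 + (Y₆ + Y₁) ^ 2)
    let CSz : ℝ := (Z₂ + Z₁) ^ 2 + (Z₃ + Z₁) ^ 2 + (Z₄ + Z₁) ^ 2 - ((Z₅ + Z₁) ^ 2 + (Z₆ + Z₁) ^ 2)
    let CSyz : ℝ := (Y₂ + Y₁) * (Z₂ + Z₁) + (Y₃ + Y₁) * (Z₃ + Z₁) + (Y₄ + Y₁) * (Z₄ + Z₁) - ((Y₅ + Y₁) * (Z₅ + Z₁) + (Y₆ + Y₁) * (Z₆ + Z₁))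
    let CSy2z : ℝ := (Y₂ + Y₁) ^ 2 * (Z₂ + Z₁) + (Y₃ + Y₁) ^ 2 * (Z₃ + Z₁) + (Y₄ + Y₁) ^ 2 * (Z₄ + Z₁) - ((Y₅ + Y₁) ^ 2 * (Z₅ + Z₁) + (Y₆ + Y₁) ^ 2 * (Z₆ + Z₁))
    let CSyz2 : ℝ := (Y₂ + Y₁) * (Z₂ + Z₁) ^ 2 + (Y₃ + Y₁) * (Z₃ + Z₁) ^ 2 + (Y₄ + Y₁) * (Z₄ + Z₁) ^ 2 - ((Y₅ + Y₁) * (Z₅ + Z₁) ^ 2 + (Y₆ + Y₁) * (Z₆ + Z₁) ^ 2)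
    let D : ℝ := 4 * CSyz ^ 2 - CSy * CSz
    D * Y₁ - (2 * CSyz * CSy2z - CSy * CSyz2) = -2 * CSyz * P1 + CSy * P2 := by
  intro yb ub Y₁ Y₂ Y₃ Y₄ Y₅ Y₆ Z₁ Z₂ Z₃ Z₄ Z₅ Z₆ P1 P2 CSy CSz CSyz CSy2z CSyz2 D
  simp only [D, CSyz2, CSy2z, CSyz, CSz, CSy, P2, P1, Z₆, Z₅, Z₄, Z₃, Z₂, Z₁, Y₆, Y₅, Y₄, Y₃, Y₂, Y₁, ub, yb]
  ring

/-- Cramer for the charge of E-root 1: `D·Z₁ − (2CSyz·CSyz2 − CSz·CSy2z) = CSz·(P1) − 2CSyz·(P2)`; on the pure locus `D·Z₁ = 2CSyz·CSyz2 − CSz·CSy2z`. -/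
theorem cramer_charge (y₁ y₂ y₃ y₄ y₅ y₆ u₁ u₂ u₃ u₄ u₅ u₆ : ℝ) :
    let yb : ℝ := (y₁ + y₂ + y₃ + y₄ - y₅ - y₆) / 2
    let ub : ℝ := (u₁ + u₂ + u₃ + u₄ - u₅ - u₆) / 2
    let Y₁ : ℝ := y₁ - yb
    let Y₂ : ℝ := y₂ - yb
    let Y₃ : ℝ := y₃ - yb
    let Y₄ : ℝ := y₄ - yb
    let Y₅ : ℝ := y₅ - yb
    let Y₆ : ℝ := y₆ - yb
    let Z₁ : ℝ := u₁ - ub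
    let Z₂ : ℝ := u₂ - ub
    let Z₃ : ℝ := u₃ - ub
    let Z₄ : ℝ := u₄ - ub
    let Z₅ : ℝ := u₅ - ub
    let Z₆ : ℝ := u₆ - ub
    let P1 : ℝ := Y₁ ^ 2 * Z₁ + Y₂ ^ 2 * Z₂ + Y₃ ^ 2 * Z₃ + Y₄ ^ 2 * Z₄ - (Y₅ ^ 2 * Z₅ + Y₆ ^ 2 * Z₆)
    let P2 : ℝ := Y₁ * Z₁ ^ 2 + Y₂ * Z₂ ^ 2 + Y₃ * Z₃ ^ 2 + Y₄ * Z₄ ^ 2 - (Y₅ * Z₅ ^ 2 + Y₆ * Z₆ ^ 2)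
    let CSy : ℝ := (Y₂ + Y₁) ^ 2 + (Y₃ + Y₁) ^ 2 + (Y₄ + Y₁) ^ 2 - ((Y₅ + Y₁) ^ 2 + (Y₆ + Y₁) ^ 2)
    let CSz : ℝ := (Z₂ + Z₁) ^ 2 + (Z₃ + Z₁) ^ 2 + (Z₄ + Z₁) ^ 2 - ((Z₅ + Z₁) ^ 2 + (Z₆ + Z₁) ^ 2)
    let CSyz : ℝ := (Y₂ + Y₁) * (Z₂ + Z₁) + (Y₃ + Y₁) * (Z₃ + Z₁) + (Y₄ + Y₁) * (Z₄ + Z₁) - ((Y₅ + Y₁) * (Z₅ + Z₁) + (Y₆ + Y₁) * (Z₆ + Z₁))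
    let CSy2z : ℝ := (Y₂ + Y₁) ^ 2 * (Z₂ + Z₁) + (Y₃ + Y₁) ^ 2 * (Z₃ + Z₁) + (Y₄ + Y₁) ^ 2 * (Z₄ + Z₁) - ((Y₅ + Y₁) ^ 2 * (Z₅ + Z₁) + (Y₆ + Y₁) ^ 2 * (Z₆ + Z₁))
    let CSyz2 : ℝ := (Y₂ + Y₁) * (Z₂ + Z₁) ^ 2 + (Y₃ + Y₁) * (Z₃ + Z₁) ^ 2 + (Y₄ + Y₁) * (Z₄ + Z₁) ^ 2 - ((Y₅ + Y₁) * (Z₅ + Z₁) ^ 2 + (Y₆ + Y₁) * (Z₆ + Z₁) ^ 2)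
    let D : ℝ := 4 * CSyz ^ 2 - CSy * CSz
    D * Z₁ - (2 * CSyz * CSyz2 - CSz * CSy2z) = CSz * P1 - 2 * CSyz * P2 := by
  intro yb ub Y₁ Y₂ Y₃ Y₄ Y₅ Y₆ Z₁ Z₂ Z₃ Z₄ Z₅ Z₆ P1 P2 CSy CSz CSyz CSy2z CSyz2 D
  simp only [D, CSyz2, CSy2z, CSyz, CSz, CSy, P2, P1, Z₆, Z₅, Z₄, Z₃, Z₂, Z₁, Y₆, Y₅, Y₄, Y₃, Y₂, Y₁, ub, yb]
  ring

/-- The cluster's second moments in full centred coordinates: `CSy = S_y − 2Y₁²`, `CSz = S_u − 2Z₁²`, `CSyz = S_{yZ} − 2Y₁Z₁`. -/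
theorem cluster_moments_full (y₁ y₂ y₃ y₄ y₅ y₆ u₁ u₂ u₃ u₄ u₅ u₆ : ℝ) :
    let yb : ℝ := (y₁ + y₂ + y₃ + y₄ - y₅ - y₆) / 2
    let ub : ℝ := (u₁ + u₂ + u₃ + u₄ - u₅ - u₆) / 2
    let Y₁ : ℝ := y₁ - yb
    let Y₂ : ℝ := y₂ - yb
    let Y₃ : ℝ := y₃ - yb
    let Y₄ : ℝ := y₄ - yb
    let Y₅ : ℝ := y₅ - yb
    let Y₆ : ℝ := y₆ - yb
    let Z₁ : ℝ := u₁ - ub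
    let Z₂ : ℝ := u₂ - ub
    let Z₃ : ℝ := u₃ - ub
    let Z₄ : ℝ := u₄ - ub
    let Z₅ : ℝ := u₅ - ub
    let Z₆ : ℝ := u₆ - ub
    let CSy : ℝ := (Y₂ + Y₁) ^ 2 + (Y₃ + Y₁) ^ 2 + (Y₄ + Y₁) ^ 2 - ((Y₅ + Y₁) ^ 2 + (Y₆ + Y₁) ^ 2)
    let CSz : ℝ := (Z₂ + Z₁) ^ 2 + (Z₃ + Z₁) ^ 2 + (Z₄ + Z₁) ^ 2 - ((Z₅ + Z₁) ^ 2 + (Z₆ + Z₁) ^ 2)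
    let CSyz : ℝ := (Y₂ + Y₁) * (Z₂ + Z₁) + (Y₃ + Y₁) * (Z₃ + Z₁) + (Y₄ + Y₁) * (Z₄ + Z₁) - ((Y₅ + Y₁) * (Z₅ + Z₁) + (Y₆ + Y₁) * (Z₆ + Z₁))
    CSy = (Y₁ ^ 2 + Y₂ ^ 2 + Y₃ ^ 2 + Y₄ ^ 2 - (Y₅ ^ 2 + Y₆ ^ 2)) - 2 * Y₁ ^ 2
    ∧ CSz = (Z₁ ^ 2 + Z₂ ^ 2 + Z₃ ^ 2 + Z₄ ^ 2 - (Z₅ ^ 2 + Z₆ ^ 2)) - 2 * Z₁ ^ 2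
    ∧ CSyz = (Y₁ * Z₁ + Y₂ * Z₂ + Y₃ * Z₃ + Y₄ * Z₄ - (Y₅ * Z₅ + Y₆ * Z₆)) - 2 * Y₁ * Z₁ := by
  intro yb ub Y₁ Y₂ Y₃ Y₄ Y₅ Y₆ Z₁ Z₂ Z₃ Z₄ Z₅ Z₆ CSy CSz CSyz
  simp only [CSyz, CSz, CSy, Z₆, Z₅, Z₄, Z₃, Z₂, Z₁, Y₆, Y₅, Y₄, Y₃, Y₂, Y₁, ub, yb]
  refine ⟨by ring, by ring, by ring⟩

end Summit.HodgeConjecture.HodgeConjecture.WeilClassTestEliminationSystem
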